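import Summits.KontsevichZagierPeriods.KontsevichZagierPeriods.Theorems.SoloBlindSecondForm
import Summits.KontsevichZagierPeriods.KontsevichZagierPeriods.Theorems.SoloBlindCyclicIntegrable
import HarnessLib

/-!
# The second-kind form, II: the cancellation at infinity

In the upper half-plane the principal branches factor **exactly**:
`(1-z)^c = e(c) z^c (1 - 1/z)^c` with `e(c) = exp(-iπc)` (because `1 - z = (-z)(1 - 1/z)`,
`arg(-z) ∈ (-π, 0)`, `arg(1 - 1/z) ∈ [0, π]`).  Hence
`g(z) = z^σ Φ(1/z)` and `g'(z) = z^{σ-1} Ψ(1/z)` with `Φ, Ψ` holomorphic near `0` and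
`Φ(0) = e(β) - λ - μ e(σ)`, `Ψ(0) = σ Φ(0)`.  Under the two real conditions
`λ + μ cos(πσ) = cos(πβ)`, `μ sin(πσ) = sin(πβ)` one has `Φ(0) = 0`, and the mean value
inequality on the disc `|w| ≤ ½` gives the **cancellation bounds**
`|g(z)| ≤ 16(1+|μ|) |z|^{σ-1}`, `|g'(z)| ≤ 16(2+|μ|) |z|^{σ-2}` for `|z| ≥ 2`, `Im z > 0`.

References: Whittaker–Watson, *Modern Analysis*, §12.43, §14.53 (connection coefficients).
-/

noncomputable section

open Set Complex MeasureTheory Filter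
open scoped Topology ComplexConjugate
open Literature.NumberTheory.Transcendental
open Literature.NumberTheory.Transcendental.KZ

namespace Summit.KontsevichZagierPeriods.KontsevichZagierPeriods.Theorems

namespace SoloBlind

/-! ## Principal powers in the upper half-plane -/

/-- The phase `e(c) = exp(-iπc)`. -/
def ephase (c : ℝ) : ℂ := cexp (((-(Real.pi * c) : ℝ) : ℂ) * I)

/-- `|e(c)| = 1`. -/
theorem norm_ephase (c : ℝ) : ‖ephase c‖ = 1 := norm_exp_ofReal_mul_I _

/-- `e(c-1) = -e(c)`. -/
theorem ephase_sub_one (c : ℝ) : ephase (c - 1) = -ephase c := by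
  rw [ephase, ephase, show (((-(Real.pi * (c - 1)) : ℝ) : ℂ)) * I =
      (((-(Real.pi * c) : ℝ) : ℂ)) * I + Real.pi * I by push_cast; ring, Complex.exp_add,
    exp_pi_mul_I]
  ring

/-- Real and imaginary parts of `e(c)`. -/
theorem ephase_re_im (c : ℝ) :
    (ephase c).re = Real.cos (Real.pi * c) ∧ (ephase c).im = -Real.sin (Real.pi * c) := by
  rw [ephase, exp_ofReal_mul_I_re, exp_ofReal_mul_I_im, Real.cos_neg, Real.sin_neg]
  exact ⟨rfl, rfl⟩

/-- `log(-z) = log z - iπ` for `Im z > 0`. -/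
theorem log_neg_of_im_pos {z : ℂ} (hz : 0 < z.im) : log (-z) = log z - Real.pi * I := by
  apply Complex.ext
  · simp [log_re]
  · simp [log_im, arg_neg_eq_arg_sub_pi_of_im_pos hz]

/-- `(-z)^c = e(c) z^c` for `Im z > 0`. -/
theorem neg_cpow_of_im_pos {z : ℂ} (hz : 0 < z.im) (c : ℝ) :
    (-z) ^ (c : ℂ) = ephase c * z ^ (c : ℂ) := by
  have hz0 : z ≠ 0 := fun h => by simp [h] at hz
  rw [cpow_def_of_ne_zero (neg_ne_zero.mpr hz0), cpow_def_of_ne_zero hz0, log_neg_of_im_pos hz,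
    ephase, ← Complex.exp_add]
  congr 1
  push_cast
  ring

/-- **The exact factorisation** `(1-z)^c = e(c) z^c (1 - z⁻¹)^c` for `Im z > 0`. -/
theorem one_sub_cpow_of_im_pos {z : ℂ} (hz : 0 < z.im) (c : ℝ) :
    (1 - z) ^ (c : ℂ) = ephase c * z ^ (c : ℂ) * (1 - z⁻¹) ^ (c : ℂ) := by
  have hz0 : z ≠ 0 := fun h => by simp [h] at hz
  have hnz : -z ≠ 0 := neg_ne_zero.mpr hz0
  have hwim : 0 < (1 - z⁻¹).im := by
    rw [sub_im, one_im, inv_im, zero_sub, neg_div, neg_neg]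
    exact div_pos hz (normSq_pos.mpr hz0)
  have hw : 1 - z⁻¹ ≠ 0 := fun h => by simp [h] at hwim
  have ha1 : arg (-z) < 0 := arg_neg_iff.mpr (by simpa using hz)
  have ha2 : 0 ≤ arg (1 - z⁻¹) := arg_nonneg_iff.mpr hwim.le
  have hsum : arg (-z) + arg (1 - z⁻¹) ∈ Ioc (-Real.pi) Real.pi :=
    ⟨by linarith [neg_pi_lt_arg (-z)], by linarith [arg_le_pi (1 - z⁻¹)]⟩
  have hlog := (log_mul_eq_add_log_iff hnz hw).mpr hsum
  have hfac : (1 : ℂ) - z = -z * (1 - z⁻¹) := by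
    field_simp
    ring
  rw [hfac, cpow_def_of_ne_zero (mul_ne_zero hnz hw), hlog, add_mul, Complex.exp_add,
    ← cpow_def_of_ne_zero hnz, ← cpow_def_of_ne_zero hw, neg_cpow_of_im_pos hz]

/-- The same with exponent written `c - 1`. -/
theorem one_sub_cpow_sub_one_of_im_pos {z : ℂ} (hz : 0 < z.im) (c : ℝ) :
    (1 - z) ^ ((c : ℂ) - 1) = ephase (c - 1) * z ^ ((c : ℂ) - 1) * (1 - z⁻¹) ^ ((c : ℂ) - 1) := by
  have h := one_sub_cpow_of_im_pos hz (c - 1)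
  push_cast at h
  exact h

/-! ## The mean value bound for `(1-w)^e - 1` on `|w| ≤ ½` -/

/-- `(½)^e ≤ 8` for `e ≥ -3`. -/
theorem half_rpow_le_eight {e : ℝ} (h : -3 ≤ e) : (1 / 2 : ℝ) ^ e ≤ 8 := by
  calc (1 / 2 : ℝ) ^ e = 2 ^ (-e) := by
        rw [one_div, Real.inv_rpow (by norm_num), Real.rpow_neg (by norm_num)]
    _ ≤ 2 ^ ((3 : ℕ) : ℝ) := Real.rpow_le_rpow_of_exponent_le (by norm_num) (by push_cast; linarith)
    _ = 8 := by rw [Real.rpow_natCast]; norm_num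

/-- **MVT**: `|(1-w)^e - 1| ≤ 16 |w|` for `|w| ≤ ½`, `e ∈ [-2, 0]`. -/
theorem norm_one_sub_cpow_sub_one_le {e : ℝ} (he : -2 ≤ e) (he0 : e ≤ 0) {w : ℂ}
    (hw : ‖w‖ ≤ 1 / 2) : ‖(1 - w) ^ (e : ℂ) - 1‖ ≤ 16 * ‖w‖ := by
  have hre : ∀ v ∈ Metric.closedBall (0 : ℂ) (1 / 2), 1 / 2 ≤ ‖1 - v‖ ∧ 1 - v ∈ slitPlane := by
    intro v hv
    rw [Metric.mem_closedBall, dist_zero_right] at hv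
    have h1 : 1 / 2 ≤ ‖1 - v‖ := by
      have h := norm_sub_norm_le (1 : ℂ) v
      rw [norm_one] at h
      linarith
    refine ⟨h1, Or.inl ?_⟩
    have h := abs_re_le_norm v
    rw [abs_le] at h
    simp only [sub_re, one_re]
    linarith [h.2]
  have hder : ∀ v ∈ Metric.closedBall (0 : ℂ) (1 / 2),
      HasDerivWithinAt (fun v : ℂ => (1 - v) ^ (e : ℂ)) ((e : ℂ) * (1 - v) ^ ((e : ℂ) - 1) * -1)
        (Metric.closedBall (0 : ℂ) (1 / 2)) v := fun v hv => by
    have h := ((hasDerivAt_id v).const_sub (1 : ℂ)).cpow_const (c := (e : ℂ)) (hre v hv).2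
    simp only [id] at h
    exact h.hasDerivWithinAt
  have hbound : ∀ v ∈ Metric.closedBall (0 : ℂ) (1 / 2),
      ‖(e : ℂ) * (1 - v) ^ ((e : ℂ) - 1) * -1‖ ≤ 16 := fun v hv => by
    have h1 := (hre v hv).1
    have hn : ‖(1 - v) ^ ((e : ℂ) - 1)‖ ≤ 8 := by
      rw [norm_cpow_ofReal_sub_one]
      exact (Real.rpow_le_rpow_of_nonpos (by norm_num) h1 (by linarith)).trans
        (half_rpow_le_eight (by linarith))
    have he' : ‖(e : ℂ)‖ ≤ 2 := by
      rw [norm_real, Real.norm_eq_abs, abs_le]; exact ⟨by linarith, by linarith⟩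
    rw [norm_mul, norm_mul, norm_neg, norm_one, mul_one]
    calc ‖(e : ℂ)‖ * ‖(1 - v) ^ ((e : ℂ) - 1)‖ ≤ 2 * 8 :=
          mul_le_mul he' hn (norm_nonneg _) (by norm_num)
      _ = 16 := by norm_num
  have h0 : (0 : ℂ) ∈ Metric.closedBall (0 : ℂ) (1 / 2) := Metric.mem_closedBall_self (by norm_num)
  have hw' : w ∈ Metric.closedBall (0 : ℂ) (1 / 2) := by
    rwa [Metric.mem_closedBall, dist_zero_right]
  have h := (convex_closedBall (0 : ℂ) (1 / 2)).norm_image_sub_le_of_norm_hasDerivWithin_le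
    hder hbound h0 hw'
  simpa using h

/-! ## `g = z^σ Φ(1/z)` and `g' = z^{σ-1} Ψ(1/z)` -/

/-- `Φ(w) = e(β) (1-w)^β - λ - μ e(σ) (1-w)^σ`. -/
def PhiK (α β l m : ℝ) (w : ℂ) : ℂ :=
  ephase β * (1 - w) ^ (β : ℂ) - l - m * (ephase (α + β) * (1 - w) ^ ((α + β : ℝ) : ℂ))

/-- `Ψ(w) = α e(β) (1-w)^β - β e(β-1) (1-w)^{β-1} - λσ + μσ e(σ-1) (1-w)^{σ-1}`. -/
def PsiK (α β l m : ℝ) (w : ℂ) : ℂ :=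
  (α : ℂ) * (ephase β * (1 - w) ^ (β : ℂ)) -
    (β : ℂ) * (ephase (β - 1) * (1 - w) ^ ((β : ℂ) - 1)) - l * ((α + β : ℝ) : ℂ) +
    m * (((α + β : ℝ) : ℂ) * (ephase (α + β - 1) * (1 - w) ^ (((α + β : ℝ) : ℂ) - 1)))

/-- **`g(z) = z^σ Φ(1/z)`** for `Im z > 0`. -/
theorem gK_eq_of_im_pos (α β l m : ℝ) {z : ℂ} (hz : 0 < z.im) :
    gK α β l m z = z ^ ((α + β : ℝ) : ℂ) * PhiK α β l m z⁻¹ := by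
  have hz0 : z ≠ 0 := fun h => by simp [h] at hz
  have hpow : z ^ (α : ℂ) * z ^ (β : ℂ) = z ^ ((α + β : ℝ) : ℂ) := by
    rw [ofReal_add, cpow_add _ _ hz0]
  rw [gK, gTwo, PhiK, one_sub_cpow_of_im_pos hz β, one_sub_cpow_of_im_pos hz (α + β)]
  linear_combination (ephase β * (1 - z⁻¹) ^ (β : ℂ)) * hpow

/-- **`g'(z) = z^{σ-1} Ψ(1/z)`** for `Im z > 0`. -/
theorem gKDer_eq_of_im_pos (α β l m : ℝ) {z : ℂ} (hz : 0 < z.im) :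
    gKDer α β l m z = z ^ (((α + β : ℝ) : ℂ) - 1) * PsiK α β l m z⁻¹ := by
  have hz0 : z ≠ 0 := fun h => by simp [h] at hz
  have hpow1 : z ^ ((α : ℂ) - 1) * z ^ (β : ℂ) = z ^ (((α + β : ℝ) : ℂ) - 1) := by
    rw [← cpow_add _ _ hz0]; push_cast; ring_nf
  have hpow2 : z ^ (α : ℂ) * z ^ ((β : ℂ) - 1) = z ^ (((α + β : ℝ) : ℂ) - 1) := by
    rw [← cpow_add _ _ hz0]; push_cast; ring_nf
  have e3 : (1 - z) ^ (((α + β : ℝ) : ℂ) - 1) = ephase (α + β - 1) * z ^ (((α + β : ℝ) : ℂ) - 1) *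
      (1 - z⁻¹) ^ (((α + β : ℝ) : ℂ) - 1) := by
    have h := one_sub_cpow_of_im_pos hz (α + β - 1)
    push_cast at h ⊢
    exact h
  rw [gKDer, gTwoDer, PsiK, one_sub_cpow_of_im_pos hz β, one_sub_cpow_sub_one_of_im_pos hz β, e3]
  linear_combination ((α : ℂ) * ephase β * (1 - z⁻¹) ^ (β : ℂ)) * hpow1 -
    ((β : ℂ) * ephase (β - 1) * (1 - z⁻¹) ^ ((β : ℂ) - 1)) * hpow2

/-! ## The cancellation conditions -/

/-- Under `λ + μ cos(πσ) = cos(πβ)` and `μ sin(πσ) = sin(πβ)`: `Φ(0) = e(β) - λ - μ e(σ) = 0`. -/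
theorem ephase_rel {α β l m : ℝ} (H1 : l + m * Real.cos (Real.pi * (α + β)) = Real.cos (Real.pi * β))
    (H2 : m * Real.sin (Real.pi * (α + β)) = Real.sin (Real.pi * β)) :
    ephase β - l - m * ephase (α + β) = 0 := by
  obtain ⟨hr1, hi1⟩ := ephase_re_im β
  obtain ⟨hr2, hi2⟩ := ephase_re_im (α + β)
  apply Complex.ext
  · simp only [sub_re, mul_re, ofReal_re, ofReal_im, zero_mul, sub_zero, zero_re, hr1, hr2]
    linarith
  · simp only [sub_im, mul_im, ofReal_re, ofReal_im, zero_mul, add_zero, zero_im, hi1, hi2, sub_zero]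
    linarith

/-- The same conditions give `λ sin(πσ) = sin(πα)` (used for the edge values). -/
theorem lam_mul_sin {α β l m : ℝ} (H1 : l + m * Real.cos (Real.pi * (α + β)) = Real.cos (Real.pi * β))
    (H2 : m * Real.sin (Real.pi * (α + β)) = Real.sin (Real.pi * β)) :
    l * Real.sin (Real.pi * (α + β)) = Real.sin (Real.pi * α) := by
  have h : Real.sin (Real.pi * α) = Real.sin (Real.pi * (α + β) - Real.pi * β) := by ring_nf
  rw [h, Real.sin_sub, ← H1, ← H2]
  ring

/-- `|Φ(w)| ≤ 16 (1 + |μ|) |w|` for `|w| ≤ ½`, under the cancellation conditions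
(`β, σ ∈ [-1, 0]`). -/
theorem norm_PhiK_le {α β l m : ℝ} (hβ : -1 ≤ β) (hβ0 : β ≤ 0) (hs : -1 ≤ α + β)
    (hs0 : α + β ≤ 0) (hK : ephase β - l - m * ephase (α + β) = 0) {w : ℂ} (hw : ‖w‖ ≤ 1 / 2) :
    ‖PhiK α β l m w‖ ≤ 16 * (1 + |m|) * ‖w‖ := by
  have hrw : PhiK α β l m w = ephase β * ((1 - w) ^ (β : ℂ) - 1) -
      m * (ephase (α + β) * ((1 - w) ^ ((α + β : ℝ) : ℂ) - 1)) +
      (ephase β - l - m * ephase (α + β)) := by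
    rw [PhiK]; ring
  have hA := norm_one_sub_cpow_sub_one_le (by linarith) hβ0 hw
  have hB := norm_one_sub_cpow_sub_one_le (by linarith) hs0 hw
  rw [hrw, hK, add_zero]
  refine (norm_sub_le _ _).trans ?_
  rw [norm_mul, norm_ephase, one_mul, norm_mul, norm_mul, norm_ephase, one_mul, norm_real,
    Real.norm_eq_abs]
  calc ‖(1 - w) ^ (β : ℂ) - 1‖ + |m| * ‖(1 - w) ^ ((α + β : ℝ) : ℂ) - 1‖
      ≤ 16 * ‖w‖ + |m| * (16 * ‖w‖) := add_le_add hA (mul_le_mul_of_nonneg_left hB (abs_nonneg m))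
    _ = 16 * (1 + |m|) * ‖w‖ := by ring

/-- `|Ψ(w)| ≤ 16 (2 + |μ|) |w|` for `|w| ≤ ½`, under the cancellation conditions
(`α, β ∈ [-1, 0]`, `σ ∈ [-1, 0]`). -/
theorem norm_PsiK_le {α β l m : ℝ} (hα : -1 ≤ α) (hα0 : α ≤ 0) (hβ : -1 ≤ β) (hβ0 : β ≤ 0)
    (hs : -1 ≤ α + β) (hs0 : α + β ≤ 0) (hK : ephase β - l - m * ephase (α + β) = 0) {w : ℂ}
    (hw : ‖w‖ ≤ 1 / 2) : ‖PsiK α β l m w‖ ≤ 16 * (2 + |m|) * ‖w‖ := by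
  have hrw : PsiK α β l m w = (α : ℂ) * (ephase β * ((1 - w) ^ (β : ℂ) - 1)) +
      (β : ℂ) * (ephase β * ((1 - w) ^ ((β : ℂ) - 1) - 1)) -
      m * (((α + β : ℝ) : ℂ) * (ephase (α + β) * ((1 - w) ^ (((α + β : ℝ) : ℂ) - 1) - 1))) +
      ((α + β : ℝ) : ℂ) * (ephase β - l - m * ephase (α + β)) := by
    rw [PsiK, ephase_sub_one, ephase_sub_one]; push_cast; ring
  have hA := norm_one_sub_cpow_sub_one_le (by linarith) hβ0 hw
  have hB : ‖(1 - w) ^ ((β : ℂ) - 1) - 1‖ ≤ 16 * ‖w‖ := by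
    have h := norm_one_sub_cpow_sub_one_le (e := β - 1) (by linarith) (by linarith) hw
    push_cast at h
    exact h
  have hC : ‖(1 - w) ^ (((α + β : ℝ) : ℂ) - 1) - 1‖ ≤ 16 * ‖w‖ := by
    have h := norm_one_sub_cpow_sub_one_le (e := α + β - 1) (by linarith) (by linarith) hw
    push_cast at h ⊢
    exact h
  have na := norm_ofReal_le_one hα hα0
  have nb := norm_ofReal_le_one hβ hβ0
  have ns : ‖((α + β : ℝ) : ℂ)‖ ≤ 1 := norm_ofReal_le_one hs hs0
  rw [hrw, hK, mul_zero, add_zero]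
  refine (norm_sub_le _ _).trans ?_
  refine (add_le_add (norm_add_le _ _) le_rfl).trans ?_
  rw [norm_mul, norm_mul, norm_ephase, one_mul, norm_mul, norm_mul, norm_ephase, one_mul,
    norm_mul, norm_mul, norm_mul, norm_ephase, one_mul, norm_real m, Real.norm_eq_abs]
  have hw0 := norm_nonneg w
  calc ‖(α : ℂ)‖ * ‖(1 - w) ^ (β : ℂ) - 1‖ + ‖(β : ℂ)‖ * ‖(1 - w) ^ ((β : ℂ) - 1) - 1‖ +
        |m| * (‖((α + β : ℝ) : ℂ)‖ * ‖(1 - w) ^ (((α + β : ℝ) : ℂ) - 1) - 1‖)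
      ≤ 1 * (16 * ‖w‖) + 1 * (16 * ‖w‖) + |m| * (1 * (16 * ‖w‖)) := by
        gcongr
    _ = 16 * (2 + |m|) * ‖w‖ := by ring

/-! ## The cancellation bounds -/

/-- **`|g(z)| ≤ 16 (1+|μ|) |z|^{σ-1}`** for `Im z > 0`, `|z| ≥ 2`. -/
theorem norm_gK_le_far {α β l m : ℝ} (hβ : -1 ≤ β) (hβ0 : β ≤ 0) (hs : -1 ≤ α + β)
    (hs0 : α + β ≤ 0) (hK : ephase β - l - m * ephase (α + β) = 0) {z : ℂ} (hz : 0 < z.im)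
    (hz2 : 2 ≤ ‖z‖) : ‖gK α β l m z‖ ≤ 16 * (1 + |m|) * ‖z‖ ^ (α + β - 1) := by
  have hz0 : 0 < ‖z‖ := by linarith
  have hw : ‖z⁻¹‖ ≤ 1 / 2 := by
    rw [norm_inv]
    exact inv_le_of_inv_le₀ (by norm_num) (by simpa using hz2)
  rw [gK_eq_of_im_pos α β l m hz, norm_mul, norm_cpow_real, Real.rpow_sub_one hz0.ne', mul_comm]
  calc ‖PhiK α β l m z⁻¹‖ * ‖z‖ ^ (α + β) ≤ 16 * (1 + |m|) * ‖z⁻¹‖ * ‖z‖ ^ (α + β) :=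
        mul_le_mul_of_nonneg_right (norm_PhiK_le hβ hβ0 hs hs0 hK hw) (by positivity)
    _ = 16 * (1 + |m|) * (‖z‖ ^ (α + β) / ‖z‖) := by rw [norm_inv]; ring

/-- **`|g'(z)| ≤ 16 (2+|μ|) |z|^{σ-2}`** for `Im z > 0`, `|z| ≥ 2`. -/
theorem norm_gKDer_le_far {α β l m : ℝ} (hα : -1 ≤ α) (hα0 : α ≤ 0) (hβ : -1 ≤ β) (hβ0 : β ≤ 0)
    (hs : -1 ≤ α + β) (hs0 : α + β ≤ 0) (hK : ephase β - l - m * ephase (α + β) = 0) {z : ℂ}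
    (hz : 0 < z.im) (hz2 : 2 ≤ ‖z‖) :
    ‖gKDer α β l m z‖ ≤ 16 * (2 + |m|) * ‖z‖ ^ (α + β - 2) := by
  have hz0 : 0 < ‖z‖ := by linarith
  have hw : ‖z⁻¹‖ ≤ 1 / 2 := by
    rw [norm_inv]
    exact inv_le_of_inv_le₀ (by norm_num) (by simpa using hz2)
  rw [gKDer_eq_of_im_pos α β l m hz, norm_mul, norm_cpow_ofReal_sub_one,
    show α + β - 2 = (α + β - 1) - 1 by ring, Real.rpow_sub_one hz0.ne' (α + β - 1), mul_comm]
  calc ‖PsiK α β l m z⁻¹‖ * ‖z‖ ^ (α + β - 1) ≤ 16 * (2 + |m|) * ‖z⁻¹‖ * ‖z‖ ^ (α + β - 1) :=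
        mul_le_mul_of_nonneg_right (norm_PsiK_le hα hα0 hβ hβ0 hs hs0 hK hw) (by positivity)
    _ = 16 * (2 + |m|) * (‖z‖ ^ (α + β - 1) / ‖z‖) := by rw [norm_inv]; ring

end SoloBlind

end Summit.KontsevichZagierPeriods.KontsevichZagierPeriods.Theorems
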